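import Literature.NumberTheory.LFunctions.DworkRationalityMeromorphy
import Mathlib.RingTheory.MvPowerSeries.Expand
import HarnessLib

/-!
# Overconvergent power series over `ℂ_p`: values on the unit polydisc (Koblitz, Ch. V §3)

Part of the bottom-up proof of Dwork's rationality theorem
(`Literature/NumberTheory/LFunctions/DworkRationality.lean`), serving the proofs of the named
facts `Dwork.dworkFredholm` (Koblitz V.3, Lemmas 3–4) and `Dwork.dworkLifting` (Koblitz V.2, V.4)
of `…/DworkRationalityMeromorphy.lean`. Koblitz uses throughout, without comment, that series
`G ∈ R₀` (`Dwork.IsOverconvergent`: `‖g_w‖ ≤ ρ^{|w|}`, `ρ < 1`) may be *evaluated* at points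
`x` of the closed unit polydisc of `Ω^ι = ℂ_p^ι` and that evaluation is multiplicative and
compatible with `G ↦ G(X^m)`; this file supplies these facts for `Dwork.evalAt`
(an unconditional sum):

* `IsOverconvergent.summable` — the family `w ↦ g_w x^w` is summable for `‖xᵢ‖ ≤ 1`
  (its terms tend to `0`; `ℂ_p` is complete and ultrametric,
  `NonarchimedeanAddGroup.summable_of_tendsto_cofinite_zero`);
* `evalAt_mul` — `(GH)(x) = G(x) H(x)` (Cauchy product of unconditional sums in a
  nonarchimedean ring, `tsum_mul_tsum_of_nonarchimedean`, regrouped along `u + v = w`);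
* `evalAt_expand : G(X^m)(x) = G(x^m)` for Mathlib's `MvPowerSeries.expand m _ G = G(X^m)`
  (Koblitz's `G_q`), and the closure properties `IsOverconvergent.mul`, `IsOverconvergent.expand`
  (Koblitz, Ch. V §3, p. 129: "`R₀` is closed under multiplication and under the map `G ↦ G_q`").

## References

* N. Koblitz, *p-adic Numbers, p-adic Analysis, and Zeta-Functions*, 2nd ed., GTM 58 (1984),
  Ch. V §3, p. 129. [Koblitz1984]
-/

open Filter Finset MvPowerSeries

noncomputable section

namespace Literature.NumberTheory.LFunctions

namespace Dwork

variable {p : ℕ} [Fact p.Prime] {ι : Type*}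

/-! ### Monomials on the unit polydisc -/

section Monomial

/-- The monomial `x^w = ∏ᵢ xᵢ^{wᵢ}`. [folklore] -/
abbrev monomialAt (x : ι → ℂ_[p]) (w : ι →₀ ℕ) : ℂ_[p] := w.prod fun i n => x i ^ n

/-- `x^{u+v} = x^u x^v`. [folklore] -/
theorem monomialAt_add (x : ι → ℂ_[p]) (u v : ι →₀ ℕ) :
    monomialAt x (u + v) = monomialAt x u * monomialAt x v :=
  Finsupp.prod_add_index' (fun i => pow_zero (x i)) fun i a b => pow_add (x i) a b

/-- `‖x^w‖ ≤ 1` on the closed unit polydisc. [folklore] -/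
theorem norm_monomialAt_le_one {x : ι → ℂ_[p]} (hx : ∀ i, ‖x i‖ ≤ 1) (w : ι →₀ ℕ) :
    ‖monomialAt x w‖ ≤ 1 := by
  rw [monomialAt, Finsupp.prod, norm_prod]
  exact Finset.prod_le_one (fun i _ => norm_nonneg _) fun i _ => by
    rw [norm_pow]; exact pow_le_one₀ (norm_nonneg _) (hx i)

/-- `x^{m • u} = (x^m)^u`. [folklore] -/
theorem monomialAt_smul (x : ι → ℂ_[p]) (m : ℕ) (u : ι →₀ ℕ) :
    monomialAt x (m • u) = monomialAt (fun i => x i ^ m) u := by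
  classical
  rw [monomialAt, monomialAt, Finsupp.prod, Finsupp.prod]
  by_cases hm : m = 0
  · subst hm
    simp
  · rw [Finsupp.support_smul_eq (by exact_mod_cast hm)]
    exact Finset.prod_congr rfl fun i _ => by rw [Finsupp.smul_apply, smul_eq_mul, pow_mul]

end Monomial

/-! ### Summability on the unit polydisc -/

section Summable

variable [Fintype ι]

/-- The terms `g_w x^w` of `G ∈ R₀` at a point of the closed unit polydisc tend to zero
(`‖g_w x^w‖ ≤ ρ^{|w|}` and only finitely many `w` have `|w| ≤ d`). [cite: Koblitz1984, Ch. V §3] -/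
theorem IsOverconvergent.tendsto_cofinite {G : MvPowerSeries ι ℂ_[p]} (hG : IsOverconvergent p G)
    {x : ι → ℂ_[p]} (hx : ∀ i, ‖x i‖ ≤ 1) :
    Tendsto (fun w => coeff w G * monomialAt x w) cofinite (nhds 0) := by
  obtain ⟨ρ, hρ0, hρ1, hρ⟩ := hG
  rw [NormedAddGroup.tendsto_nhds_zero]
  intro ε hε
  obtain ⟨d, hd⟩ := exists_pow_lt_of_lt_one hε hρ1
  rw [Filter.eventually_cofinite]
  refine (Finsupp.finite_of_degree_le d).subset fun w hw => ?_
  rw [Set.mem_setOf_eq, not_lt] at hw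
  by_contra hdeg
  rw [Set.mem_setOf_eq, not_le] at hdeg
  have hlt : ‖coeff w G * monomialAt x w‖ < ε :=
    calc ‖coeff w G * monomialAt x w‖ = ‖coeff w G‖ * ‖monomialAt x w‖ := norm_mul _ _
      _ ≤ ρ ^ Finsupp.degree w * 1 :=
          mul_le_mul (hρ w) (norm_monomialAt_le_one hx w) (norm_nonneg _) (pow_nonneg hρ0 _)
      _ ≤ ρ ^ d := by rw [mul_one]; exact pow_le_pow_of_le_one hρ0 hρ1.le hdeg.le
      _ < ε := hd
  exact absurd hlt (not_lt.mpr hw)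

/-- **Convergence on the closed unit polydisc** (Koblitz, Ch. V §3, p. 129: "power series in `R₀`
must converge when all the variables are in a disc strictly bigger than `D(1)`"): for `G ∈ R₀` and
`‖xᵢ‖ ≤ 1` the family `w ↦ g_w x^w` is summable, so that `evalAt p G x = ∑_w g_w x^w` is an
honest sum (`ℂ_p` is complete and ultrametric). [cite: Koblitz1984, Ch. V §3] -/
theorem IsOverconvergent.summable {G : MvPowerSeries ι ℂ_[p]} (hG : IsOverconvergent p G)
    {x : ι → ℂ_[p]} (hx : ∀ i, ‖x i‖ ≤ 1) :
    Summable fun w => coeff w G * monomialAt x w :=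
  NonarchimedeanAddGroup.summable_of_tendsto_cofinite_zero (hG.tendsto_cofinite hx)

end Summable

/-! ### Multiplicativity of evaluation -/

section Mul

/-- `ℂ_p` is a nonarchimedean topological ring in the sense of Mathlib's `NonarchimedeanRing`
(every neighbourhood of `0` contains an open additive subgroup): its norm is ultrametric, and
Mathlib records the additive-group statement as `IsUltrametricDist.nonarchimedeanAddGroup` but
has no instance of the ring-level class for `ℂ_[p]` (nothing is overridden). Needed for the
Cauchy product of unconditional sums (`tsum_mul_tsum_of_nonarchimedean`). [folklore] -/
instance instNonarchimedeanRingPadicComplex : NonarchimedeanRing ℂ_[p] where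
  is_nonarchimedean := NonarchimedeanAddGroup.is_nonarchimedean

/-- **`(GH)(x) = G(x) H(x)`** for summable evaluations (e.g. `G, H ∈ R₀`, `‖xᵢ‖ ≤ 1`): the
product of two unconditional sums in the nonarchimedean field `ℂ_p` is the unconditional sum of
the products (`tsum_mul_tsum_of_nonarchimedean`), regrouped along the finite fibres `u + v = w`
of the Cauchy product. [folklore] -/
theorem evalAt_mul {G H : MvPowerSeries ι ℂ_[p]} {x : ι → ℂ_[p]}
    (hG : Summable fun w => coeff w G * monomialAt x w)
    (hH : Summable fun w => coeff w H * monomialAt x w) :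
    evalAt p (G * H) x = evalAt p G x * evalAt p H x := by
  classical
  -- the product family on `U × U` (elaborated from the lemmas themselves, `( … :)`, so that no
  -- higher-order unification against a prescribed statement is needed)
  have hFsum := (hG.mul_of_nonarchimedean hH :)
  have hprod := (tsum_mul_tsum_of_nonarchimedean hG hH :)
  -- regroup along the finite fibres `u + v = w`
  let π : (ι →₀ ℕ) × (ι →₀ ℕ) → (ι →₀ ℕ) := fun uv => uv.1 + uv.2
  have hfw := (hFsum.hasSum.tsum_fiberwise π :)
  have hinner : ∀ w, ∑' uv : π ⁻¹' {w},
      (coeff uv.1.1 G * monomialAt x uv.1.1) * (coeff uv.1.2 H * monomialAt x uv.1.2) =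
      coeff w (G * H) * monomialAt x w := by
    intro w
    rw [tsum_subtype (π ⁻¹' {w}) fun uv : (ι →₀ ℕ) × (ι →₀ ℕ) =>
      (coeff uv.1 G * monomialAt x uv.1) * (coeff uv.2 H * monomialAt x uv.2),
      tsum_eq_sum (s := antidiagonal w)]
    · rw [coeff_mul, Finset.sum_mul]
      refine Finset.sum_congr rfl fun uv huv => ?_
      rw [mem_antidiagonal] at huv
      rw [Set.indicator_of_mem (show uv ∈ π ⁻¹' {w} from huv), ← huv, monomialAt_add]
      ring
    · intro uv huv
      rw [mem_antidiagonal] at huv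
      exact Set.indicator_of_notMem (show uv ∉ π ⁻¹' {w} from huv)
        fun uv : (ι →₀ ℕ) × (ι →₀ ℕ) =>
          (coeff uv.1 G * monomialAt x uv.1) * (coeff uv.2 H * monomialAt x uv.2)
  calc evalAt p (G * H) x = ∑' w, coeff w (G * H) * monomialAt x w := rfl
    _ = ∑' w, ∑' uv : π ⁻¹' {w},
          (coeff uv.1.1 G * monomialAt x uv.1.1) * (coeff uv.1.2 H * monomialAt x uv.1.2) :=
        tsum_congr fun w => (hinner w).symm
    _ = _ := hfw.tsum_eq
    _ = evalAt p G x * evalAt p H x := hprod.symm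

end Mul

/-! ### The substitution `G ↦ G(X^m)` (Mathlib `MvPowerSeries.expand`) -/

section Expand

/-- **`G(X^m)(x) = G(x^m)`** for `G(X^m) = MvPowerSeries.expand m _ G` (reindex the unconditional
sum along the injection `u ↦ m • u`, off whose image the coefficients of `G(X^m)` vanish,
`MvPowerSeries.support_expand_subset`). [folklore] -/
theorem evalAt_expand {m : ℕ} (hm : m ≠ 0) (G : MvPowerSeries ι ℂ_[p]) (x : ι → ℂ_[p]) :
    evalAt p (expand m hm G) x = evalAt p G fun i => x i ^ m := by
  classical
  rw [evalAt, evalAt, ← (nsmul_right_injective (M := ι →₀ ℕ) hm).tsum_eq]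
  · refine tsum_congr fun u => ?_
    change coeff (m • u) (expand m hm G) * monomialAt x (m • u) = coeff u G * monomialAt _ u
    rw [coeff_expand_smul, monomialAt_smul]
  · intro w hw
    rw [Function.mem_support] at hw
    have hw' : coeff w (expand m hm G) ≠ 0 := fun h0 => hw (by
      change coeff w (expand m hm G) * monomialAt x w = 0
      rw [h0, zero_mul])
    obtain ⟨u, -, hu⟩ := support_expand_subset m hm G hw'
    exact ⟨u, hu⟩

/-- `R₀` is closed under `G ↦ G(X^m)`, `m ≥ 1` (Koblitz, Ch. V §3, p. 129), with radius parameter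
`ρ^{1/m}`. [cite: Koblitz1984, Ch. V §3] -/
theorem IsOverconvergent.expand {G : MvPowerSeries ι ℂ_[p]} (hG : IsOverconvergent p G) {m : ℕ}
    (hm : m ≠ 0) : IsOverconvergent p (MvPowerSeries.expand m hm G) := by
  classical
  obtain ⟨ρ, hρ0, hρ1, hρ⟩ := hG
  refine ⟨ρ ^ ((m : ℝ)⁻¹), Real.rpow_nonneg hρ0 _,
    Real.rpow_lt_one hρ0 hρ1 (inv_pos.mpr (by exact_mod_cast Nat.pos_of_ne_zero hm)), fun w => ?_⟩
  by_cases h : coeff w (MvPowerSeries.expand m hm G) = 0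
  · rw [h, norm_zero]
    exact pow_nonneg (Real.rpow_nonneg hρ0 _) _
  · obtain ⟨u, -, rfl⟩ := support_expand_subset m hm G h
    change ‖coeff (m • u) (MvPowerSeries.expand m hm G)‖ ≤ _
    rw [coeff_expand_smul, map_nsmul, smul_eq_mul, pow_mul, Real.rpow_inv_natCast_pow hρ0 hm]
    exact hρ u

/-- `R₀` is closed under multiplication (ultrametric estimate of the Cauchy product;
Koblitz, Ch. V §3, p. 129). [cite: Koblitz1984, Ch. V §3] -/
theorem IsOverconvergent.mul {G H : MvPowerSeries ι ℂ_[p]} (hG : IsOverconvergent p G)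
    (hH : IsOverconvergent p H) : IsOverconvergent p (G * H) := by
  classical
  obtain ⟨ρ, hρ0, hρ1, hρ⟩ := hG
  obtain ⟨ρ', hρ0', hρ1', hρ'⟩ := hH
  refine ⟨max ρ ρ', le_max_of_le_left hρ0, max_lt hρ1 hρ1', fun w => ?_⟩
  rw [coeff_mul]
  refine IsUltrametricDist.norm_sum_le_of_forall_le_of_nonneg (pow_nonneg (le_max_of_le_left hρ0) _)
    fun uv huv => ?_
  rw [mem_antidiagonal] at huv
  rw [norm_mul, ← huv, map_add, pow_add]
  exact mul_le_mul ((hρ _).trans (pow_le_pow_left₀ hρ0 (le_max_left _ _) _))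
    ((hρ' _).trans (pow_le_pow_left₀ hρ0' (le_max_right _ _) _)) (norm_nonneg _)
    (pow_nonneg (le_max_of_le_left hρ0) _)

/-- Finite products of members of `R₀` lie in `R₀`. [folklore] -/
theorem IsOverconvergent.prod {α : Type*} (t : Finset α) {G : α → MvPowerSeries ι ℂ_[p]}
    (hG : ∀ a ∈ t, IsOverconvergent p (G a)) : IsOverconvergent p (∏ a ∈ t, G a) := by
  classical
  induction t using Finset.induction_on with
  | empty => rw [prod_empty]; exact isOverconvergent_one p
  | insert a t ha ih =>
    rw [prod_insert ha]
    exact (hG a (mem_insert_self a t)).mul (ih fun b hb => hG b (mem_insert_of_mem hb))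

variable [Fintype ι] in
/-- `G(x) G(x^q) ⋯ G(x^{q^{s-1}}) = (∏_{l<s} G(X^{qˡ}))(x)` on the unit polydisc for `G ∈ R₀`
(the series to which Koblitz applies Lemma 3 in the proof for `s > 1`, Ch. V §3, p. 130). [cite: Koblitz1984, Ch. V §3 Lemma 3] -/
theorem prod_evalAt_pow_eq {G : MvPowerSeries ι ℂ_[p]} (hG : IsOverconvergent p G) {q : ℕ}
    (hq : q ≠ 0) {x : ι → ℂ_[p]} (hx : ∀ i, ‖x i‖ ≤ 1) (s : ℕ) :
    ∏ l ∈ range s, evalAt p G (fun i => x i ^ q ^ l) =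
      evalAt p (∏ l ∈ range s, expand (q ^ l) (pow_ne_zero l hq) G) x := by
  classical
  induction s with
  | zero =>
    rw [prod_range_zero, prod_range_zero, evalAt, tsum_eq_single 0]
    · rw [MvPowerSeries.coeff_zero_one, one_mul]
      exact Finsupp.prod_zero_index.symm
    · intro w hw
      rw [MvPowerSeries.coeff_one, if_neg hw, zero_mul]
  | succ s ih =>
    rw [prod_range_succ, prod_range_succ, ih, ← evalAt_expand (pow_ne_zero s hq) G x, evalAt_mul]
    · exact (IsOverconvergent.prod _ fun l _ => hG.expand (pow_ne_zero l hq)).summable hx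
    · exact (hG.expand (pow_ne_zero s hq)).summable hx

end Expand

end Dwork

end Literature.NumberTheory.LFunctions
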